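import Summits.Ventures.PercRepro.RankLevelSetExplicitLin2KeyL

/-!
# PercRepro — THE LEVEL-15 THEOREM-M ROW OF C-025: THE KEY AT `p = 36 940`, PART A: chunks 1 … 4 of 8 (p4, S4 feed)

`proofs/P4-gen18.md`. The THEOREM-M key `KeyL 15 36940 d` (RankLevelSetExplicitLin2KeyL) at the coranks of the level-15 row
`16 … 16399`, by the kernel (`decide`, four chunks of 4 096); the row is assembled in
RankLevelSetExplicitLin2IndepRowFifteen. Axioms: standard.
-/

namespace PercRepro

namespace ThmN

namespace Explicit

/-- The THEOREM-M key row at `(q, p) = (15, 36 940)`, chunk 1 of 8: coranks `16 … 4111`, by the kernel. -/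
theorem key_fifteen_indep_row_1 : ∀ t < 4096, KeyL 15 36940 (16 + t) := by decide +kernel

/-- The THEOREM-M key row at `(q, p) = (15, 36 940)`, chunk 2 of 8: coranks `4112 … 8207`, by the kernel. -/
theorem key_fifteen_indep_row_2 : ∀ t < 4096, KeyL 15 36940 (16 + (4096 + t)) := by decide +kernel

/-- The THEOREM-M key row at `(q, p) = (15, 36 940)`, chunk 3 of 8: coranks `8208 … 12303`, by the kernel. -/
theorem key_fifteen_indep_row_3 : ∀ t < 4096, KeyL 15 36940 (16 + (8192 + t)) := by decide +kernel

/-- The THEOREM-M key row at `(q, p) = (15, 36 940)`, chunk 4 of 8: coranks `12304 … 16399`, by the kernel. -/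
theorem key_fifteen_indep_row_4 : ∀ t < 4096, KeyL 15 36940 (16 + (12288 + t)) := by decide +kernel

end Explicit

end ThmN

end PercRepro
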